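import Mathlib
import HarnessLib
import Summits.HubbardSuperconductivity.HubbardSuperconductivity.Theorems.KLProgrammeKLRegimeCountertermJacksonRemainderAngularFactorAE

/-!
# Route `KLProgramme`, crux K3 — gen-8 ENGINE-FLOW child (stmt-HubbardSuperconductivity-20437 `KLRegimeEngineV17F2`), stub (C)
# `stub_twoLeg_curvature`: the (C1) JACKSON-REMAINDER DOOR v3 — the CUTOFF-WEIGHTED regrouping (finite moments at every order)

Seat hubbard-kl-k3c3-p1 (g7; row «δμ-flow with klAngularMean constant piece»).  Door v2 (`…Structured`, `…StructuredLocal`,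
`…AngularFactorAE`) splits the displaced difference of `G = m + χ·A` as `∂ᵏ[(χ_v − 1)·A_v] + (∂ᵏA_v − ∂ᵏA_0)` and majorises the two
terms SEPARATELY.  At the far displacement whose centred displaced point is the origin the displaced angular factor `A_v = g∘arg` has
`|∂ʲA_v(θ)| ≍ |γ′|ʲ/|z̃|ʲ`, which is not integrable over the smoothing square for `j ≥ 2`; there `χ_v = 0` but `|χ_v − 1| = 1`, so the
separated mixed moments `∫J̃J̃·|χ_v − 1|·|∂ᵏA_v|` and the bare transport moment `∫J̃J̃·|∂ᵏA_v − ∂ᵏA_0|` are `+∞` (k ≥ 2): the v2 integrated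
theorems are true but their hypotheses cannot be met beyond first order (evidence `C1-CERT-WEIGHTED.md` on 20437).

This file regroups EXACTLY so that every displaced angular jet carries a CUTOFF factor (supported in the tube, where `|z̃| ≥ 1.6`):

  `∂ᵏ[G∘(γ−v)](θ) − ∂ᵏ[G∘γ](θ) = Σ_{i=1}^{k} C(k,i)·∂ⁱχ_v(θ)·∂^{k−i}A_v(θ) + χ_v(θ)·(∂ᵏA_v(θ) − ∂ᵏA_0(θ)) + (χ_v(θ) − 1)·∂ᵏA_0(θ)`

(§1, `iteratedDeriv_displacedDiff_eq_weighted`, exact Leibniz `iteratedDeriv_fun_mul`), the pointwise bound with PRODUCT majorants (§1), the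
whole-square a.e. integrated form with integrable (step-function) majorants (§2, **`abs_iteratedDeriv_jhigh1_comp_curve_le_weightedMoments_ae`**)
and the flow instance with the bundle's own angular factor (§3, **`flowPiece_reading_remainder_jets_weightedMoments_ae`**: the (C1) object's jets
`≤ Σ_{1≤i≤k} C(k,i)·Mx i + Tm + Em`).  These are the targets of the (C1) certificate at `n+1 ≤ 3` (27 kernel moments per `d`).
Pure real analysis + unfolding; no definitions; nothing here asserts superconductivity.
-/

noncomputable section

namespace Summit.HubbardSuperconductivity.HubbardSuperconductivity.Theorems.KLRegimeSplit

set_option linter.dupNamespace false -- summit = problem name (single-conjunct summit), D-0017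

open Real MeasureTheory Filter Metric Function
open scoped Topology ContDiff
open Literature.Analysis.Fourier.TrigApprox Literature.MathematicalPhysics.QuantumLattice

/-! ## §1 The cutoff-weighted regrouping, pointwise -/

section Pointwise

variable {G χ A : EuclideanSpace ℝ (Fin 2) → ℝ} {m : ℝ} {γ : ℝ → EuclideanSpace ℝ (Fin 2)} {v : EuclideanSpace ℝ (Fin 2)} {θ : ℝ}

/-- **The cutoff-weighted regrouping, exactly**: `G = m + χ·A`, `χ ≡ 1` along `γ`, the displaced cutoff `C⁴`, the displaced angular factor
`C⁴` AT `θ`; then for `k ≤ 4`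
`∂ᵏ[G∘(γ−v)](θ) − ∂ᵏ[G∘γ](θ) = Σ_{i<k} C(k,i+1)·∂^{i+1}χ_v(θ)·∂^{k−1−i}A_v(θ) + χ_v(θ)·(∂ᵏA_v(θ) − ∂ᵏ[A∘γ](θ)) + (χ_v(θ) − 1)·∂ᵏ[A∘γ](θ)`. -/
theorem iteratedDeriv_displacedDiff_eq_weighted (hGdec : ∀ q, G q = m + χ q * A q) (hflat : ∀ ϑ : ℝ, χ (γ ϑ) = 1)
    (hcv : ContDiff ℝ 4 (fun ϑ : ℝ => χ (γ ϑ - v))) (hAv : ContDiffAt ℝ 4 (fun ϑ : ℝ => A (γ ϑ - v)) θ) {k : ℕ} (hk : k ≤ 4) :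
    iteratedDeriv k (fun ϑ : ℝ => G (γ ϑ - v)) θ - iteratedDeriv k (fun ϑ : ℝ => G (γ ϑ)) θ =
      (∑ i ∈ Finset.range k, ((k.choose (i + 1) : ℕ) : ℝ) * iteratedDeriv (i + 1) (fun ϑ : ℝ => χ (γ ϑ - v)) θ *
          iteratedDeriv (k - (i + 1)) (fun ϑ : ℝ => A (γ ϑ - v)) θ) +
        χ (γ θ - v) * (iteratedDeriv k (fun ϑ : ℝ => A (γ ϑ - v)) θ - iteratedDeriv k (fun ϑ : ℝ => A (γ ϑ)) θ) +
        (χ (γ θ - v) - 1) * iteratedDeriv k (fun ϑ : ℝ => A (γ ϑ)) θ := by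
  have hk' : (k : WithTop ℕ∞) ≤ 4 := by exact_mod_cast hk
  have ev : (fun ϑ : ℝ => G (γ ϑ - v)) = fun ϑ : ℝ => m + (fun ϑ : ℝ => χ (γ ϑ - v)) ϑ * (fun ϑ : ℝ => A (γ ϑ - v)) ϑ := by
    funext ϑ; simp only [hGdec]
  have e0 : (fun ϑ : ℝ => G (γ ϑ)) = fun ϑ : ℝ => m + A (γ ϑ) := by
    funext ϑ; rw [hGdec, hflat ϑ, one_mul]
  rw [ev, e0]
  rcases Nat.eq_zero_or_pos k with rfl | hk0
  · simp only [iteratedDeriv_zero, Finset.range_zero, Finset.sum_empty]; ring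
  · rw [iteratedDeriv_const_add hk0, iteratedDeriv_const_add hk0,
      iteratedDeriv_fun_mul (hcv.contDiffAt.of_le hk') (hAv.of_le hk'), Finset.sum_range_succ']
    simp only [Nat.choose_zero_right, Nat.cast_one, one_mul, iteratedDeriv_zero, Nat.sub_zero]
    ring

/-- **THE POINTWISE CUTOFF-WEIGHTED BOUND** with PRODUCT majorants: if `|∂ⁱχ_v(θ)|·|∂^{k−i}A_v(θ)| ≤ p i` (`1 ≤ i ≤ k`),
`|χ_v(θ)|·|∂ᵏA_v(θ) − ∂ᵏ[A∘γ](θ)| ≤ t` and `|χ_v(θ) − 1|·|∂ᵏ[A∘γ](θ)| ≤ e`, then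
`|∂ᵏ[G∘(γ−v)](θ) − ∂ᵏ[G∘γ](θ)| ≤ Σ_{i<k} C(k,i+1)·p (i+1) + t + e` (`k ≤ 4`). -/
theorem abs_iteratedDeriv_displacedDiff_le_weighted (hGdec : ∀ q, G q = m + χ q * A q) (hflat : ∀ ϑ : ℝ, χ (γ ϑ) = 1)
    (hcv : ContDiff ℝ 4 (fun ϑ : ℝ => χ (γ ϑ - v))) (hAv : ContDiffAt ℝ 4 (fun ϑ : ℝ => A (γ ϑ - v)) θ) {k : ℕ} (hk : k ≤ 4)
    {p : ℕ → ℝ} (hp : ∀ i, 1 ≤ i → i ≤ k →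
      |iteratedDeriv i (fun ϑ : ℝ => χ (γ ϑ - v)) θ| * |iteratedDeriv (k - i) (fun ϑ : ℝ => A (γ ϑ - v)) θ| ≤ p i)
    {t : ℝ} (ht : |χ (γ θ - v)| * |iteratedDeriv k (fun ϑ : ℝ => A (γ ϑ - v)) θ - iteratedDeriv k (fun ϑ : ℝ => A (γ ϑ)) θ| ≤ t)
    {e : ℝ} (he : |χ (γ θ - v) - 1| * |iteratedDeriv k (fun ϑ : ℝ => A (γ ϑ)) θ| ≤ e) :
    |iteratedDeriv k (fun ϑ : ℝ => G (γ ϑ - v)) θ - iteratedDeriv k (fun ϑ : ℝ => G (γ ϑ)) θ| ≤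
      (∑ i ∈ Finset.range k, ((k.choose (i + 1) : ℕ) : ℝ) * p (i + 1)) + t + e := by
  rw [iteratedDeriv_displacedDiff_eq_weighted hGdec hflat hcv hAv hk]
  refine (abs_add_le _ _).trans (add_le_add ((abs_add_le _ _).trans (add_le_add ?_ ?_)) ?_)
  · refine (Finset.abs_sum_le_sum_abs _ _).trans (Finset.sum_le_sum fun i hi => ?_)
    have hik : i + 1 ≤ k := Nat.succ_le_of_lt (Finset.mem_range.mp hi)
    rw [abs_mul, abs_mul, Nat.abs_cast, mul_assoc]
    exact mul_le_mul_of_nonneg_left (hp (i + 1) (Nat.le_add_left 1 i) hik) (Nat.cast_nonneg _)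
  · rw [abs_mul]; exact ht
  · rw [abs_mul]; exact he

end Pointwise

/-! ## §2 The integrated form: cutoff-weighted moments, whole square, a.e. hypotheses, integrable majorants -/

section Integrated

variable (d : ℕ) {F : (Fin 2 → ℝ) → ℝ} {χ A : EuclideanSpace ℝ (Fin 2) → ℝ} {m : ℝ} {γ : ℝ → EuclideanSpace ℝ (Fin 2)}

/-- **THE (C1) DOOR v3 IN CUTOFF-WEIGHTED MOMENT FORM.**  `F∘ofLp = m + χ·A`, `χ∘γ ≡ 1`, `χ ∈ C⁴`; for a.e. `w` in the smoothing square the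
displaced angular factor `A∘(γ − v_w)` is `C⁴` at `θ` and the PRODUCT majorants hold: `|∂ⁱχ_w(θ)|·|∂^{k−i}A_w(θ)| ≤ pdef i w` (`1 ≤ i ≤ k`),
`|χ_w(θ)|·|∂ᵏA_w(θ) − ∂ᵏ[A∘γ](θ)| ≤ tdef w`, `|χ_w(θ) − 1|·|∂ᵏ[A∘γ](θ)| ≤ edef w`, with `J̃J̃·pdef i`, `J̃J̃·tdef`, `J̃J̃·edef` integrable
(cellwise-constant certificate enclosures qualify) and moments `≤ Mx i`, `≤ Tm`, `≤ Em`.  Then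
`|∂ᵏ[(F − 𝒥_dF)∘ofLp∘γ](θ)| ≤ Σ_{i<k} C(k,i+1)·Mx (i+1) + Tm + Em` (`k ≤ 4`). -/
theorem abs_iteratedDeriv_jhigh1_comp_curve_le_weightedMoments_ae (hF : Continuous F)
    (hG : ContDiff ℝ 4 (fun q : EuclideanSpace ℝ (Fin 2) => F (WithLp.ofLp q))) (hγ : ContDiff ℝ 4 γ) {k : ℕ} (hk : k ≤ 4) (θ : ℝ)
    (hGdec : ∀ q, F (WithLp.ofLp q) = m + χ q * A q) (hflat : ∀ ϑ : ℝ, χ (γ ϑ) = 1) (hχ : ContDiff ℝ 4 χ)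
    {pdef : ℕ → ℝ × ℝ → ℝ} {tdef edef : ℝ × ℝ → ℝ}
    (hpint : ∀ i, 1 ≤ i → i ≤ k → Integrable (fun w => jweight d w * pdef i w) jmeas)
    (htint : Integrable (fun w => jweight d w * tdef w) jmeas) (heint : Integrable (fun w => jweight d w * edef w) jmeas)
    (hw : ∀ᵐ w ∂jmeas, ContDiffAt ℝ 4 (fun ϑ : ℝ => A (γ ϑ - jshift w)) θ ∧
      (∀ i, 1 ≤ i → i ≤ k → |iteratedDeriv i (fun ϑ : ℝ => χ (γ ϑ - jshift w)) θ| *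
          |iteratedDeriv (k - i) (fun ϑ : ℝ => A (γ ϑ - jshift w)) θ| ≤ pdef i w) ∧
      |χ (γ θ - jshift w)| * |iteratedDeriv k (fun ϑ : ℝ => A (γ ϑ - jshift w)) θ - iteratedDeriv k (fun ϑ : ℝ => A (γ ϑ)) θ| ≤ tdef w ∧
      |χ (γ θ - jshift w) - 1| * |iteratedDeriv k (fun ϑ : ℝ => A (γ ϑ)) θ| ≤ edef w)
    {Mx : ℕ → ℝ} (hMx : ∀ i, 1 ≤ i → i ≤ k → ∫ w, jweight d w * pdef i w ∂jmeas ≤ Mx i)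
    {Tm : ℝ} (hTm : ∫ w, jweight d w * tdef w ∂jmeas ≤ Tm) {Em : ℝ} (hEm : ∫ w, jweight d w * edef w ∂jmeas ≤ Em) :
    |iteratedDeriv k ((fun q : EuclideanSpace ℝ (Fin 2) => jhigh1 d F (WithLp.ofLp q)) ∘ γ) θ| ≤
      (∑ i ∈ Finset.range k, ((k.choose (i + 1) : ℕ) : ℝ) * Mx (i + 1)) + Tm + Em := by
  set P : ℝ × ℝ → ℝ := fun w => (∑ i ∈ Finset.range k, ((k.choose (i + 1) : ℕ) : ℝ) * pdef (i + 1) w) + tdef w + edef w with hP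
  have ii : ∀ i ∈ Finset.range k, Integrable (fun w => ((k.choose (i + 1) : ℕ) : ℝ) * (jweight d w * pdef (i + 1) w)) jmeas := by
    intro i hi
    exact (hpint (i + 1) (Nat.le_add_left 1 i) (Nat.succ_le_of_lt (Finset.mem_range.mp hi))).const_mul _
  have iS : Integrable (fun w => ∑ i ∈ Finset.range k, ((k.choose (i + 1) : ℕ) : ℝ) * (jweight d w * pdef (i + 1) w)) jmeas :=
    integrable_finsetSum _ ii
  have eP : (fun w => jweight d w * P w) =
      fun w => (∑ i ∈ Finset.range k, ((k.choose (i + 1) : ℕ) : ℝ) * (jweight d w * pdef (i + 1) w)) + jweight d w * tdef w +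
        jweight d w * edef w := by
    funext w; simp only [hP, mul_add, Finset.mul_sum]; congr 1; congr 1; refine Finset.sum_congr rfl fun i _ => ?_; ring
  have iP : Integrable (fun w : ℝ × ℝ => jweight d w * P w) jmeas := by rw [eP]; exact (iS.add htint).add heint
  have hM : ∀ᵐ w ∂jmeas,
      |iteratedDeriv k (fun ϑ : ℝ => F (WithLp.ofLp (γ ϑ - jshift w))) θ - iteratedDeriv k (fun ϑ : ℝ => F (WithLp.ofLp (γ ϑ))) θ| ≤ P w := by
    refine hw.mono fun w hw => ?_
    obtain ⟨hAv, hp, ht, he⟩ := hw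
    have hcv : ContDiff ℝ 4 (fun ϑ : ℝ => χ (γ ϑ - jshift w)) := hχ.comp (hγ.sub contDiff_const)
    exact abs_iteratedDeriv_displacedDiff_le_weighted (G := fun q : EuclideanSpace ℝ (Fin 2) => F (WithLp.ofLp q)) hGdec hflat hcv hAv hk
      (p := fun i => pdef i w) hp ht he
  refine (abs_iteratedDeriv_jhigh1_comp_curve_le_integral_ae d hF hG hγ hk θ iP hM).trans ?_
  have iST : Integrable (fun w => (∑ i ∈ Finset.range k, ((k.choose (i + 1) : ℕ) : ℝ) * (jweight d w * pdef (i + 1) w)) +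
      jweight d w * tdef w) jmeas := iS.add htint
  rw [eP, integral_add iST heint, integral_add iS htint, integral_finsetSum _ ii]
  refine add_le_add (add_le_add (Finset.sum_le_sum fun i hi => ?_) hTm) hEm
  rw [integral_const_mul]
  exact mul_le_mul_of_nonneg_left (hMx (i + 1) (Nat.le_add_left 1 i) (Nat.succ_le_of_lt (Finset.mem_range.mp hi))) (Nat.cast_nonneg _)

end Integrated

/-! ## §3 The flow instance with the bundle's own angular factor -/

section Flow

variable {L M : ℕ} [NeZero L] [NeZero M]

/-- **THE (C1) DOOR v3 AT THE FLOW PIECE — CUTOFF-WEIGHTED MOMENTS, WHOLE SQUARE, A.E. MAJORANTS.**  With `f = ν_n(K_n)` (`C⁴`; read on the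
curve: `hon`; its polar-angle reading `hang`), `γ = toLp ∘ k_F^{K′}` (`C⁴`, inside the flat tube: `hflat`), `χ = klFlatCutoffFn μ`,
`A_w(ϑ) = f(angle(γϑ − v_w)) − mean f`, `g = f − mean f` and `d = klFlowDeg n`: if for a.e. `w` in the smoothing square
`|∂ⁱ[χ∘(γ−v_w)](θ)|·|∂^{k−i}A_w(θ)| ≤ pdef i w` (`1 ≤ i ≤ k`), `|χ(γθ − v_w)|·|∂ᵏA_w(θ) − g^{(k)}(θ)| ≤ tdef w` and
`|χ(γθ − v_w) − 1|·|g^{(k)}(θ)| ≤ edef w` (majorants integrable against `J̃J̃`; cellwise-constant enclosures qualify), with moments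
`∫J̃J̃·pdef i ≤ Mx i`, `∫J̃J̃·tdef ≤ Tm`, `∫J̃J̃·edef ≤ Em`, then
`|∂ᵏ[ν_n(K_n) − (klFlowPiece n).eval∘k_F^{K′}](θ)| ≤ Σ_{i<k} C(k,i+1)·Mx (i+1) + Tm + Em` (`k ≤ 4`). -/
theorem flowPiece_reading_remainder_jets_weightedMoments_ae (β U : ℝ) {μ : ℝ} (hμ : μ ∈ klWindowC) (n : ℕ) (K' : TrigPolyC4v)
    (hf : ContDiff ℝ 4 fun θ : ℝ => klLocalPart L M β U μ (klFlowFrameU L M β U μ n) n θ)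
    (hon : ∀ θ, klFrameExtFn μ (fun θ => klLocalPart L M β U μ (klFlowFrameU L M β U μ n) n θ) (klFermiPoint μ K' θ) =
      klLocalPart L M β U μ (klFlowFrameU L M β U μ n) n θ)
    (hang : ∀ θ, klLocalPart L M β U μ (klFlowFrameU L M β U μ n) n (polarAngle (centredRep (klFermiPoint μ K' θ))) =
      klLocalPart L M β U μ (klFlowFrameU L M β U μ n) n θ)
    (hγ : ContDiff ℝ 4 fun θ => (WithLp.toLp 2 (klFermiPoint μ K' θ) : EuclideanSpace ℝ (Fin 2)))
    (hflat : ∀ ϑ : ℝ, klFlatCutoffFn μ (klFermiPoint μ K' ϑ) = 1)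
    {k : ℕ} (hk : k ≤ 4) (θ : ℝ)
    {pdef : ℕ → ℝ × ℝ → ℝ} {tdef edef : ℝ × ℝ → ℝ}
    (hpint : ∀ i, 1 ≤ i → i ≤ k → Integrable (fun w => jweight (klFlowDeg n) w * pdef i w) jmeas)
    (htint : Integrable (fun w => jweight (klFlowDeg n) w * tdef w) jmeas)
    (heint : Integrable (fun w => jweight (klFlowDeg n) w * edef w) jmeas)
    (hw : ∀ᵐ w ∂jmeas,
      (∀ i, 1 ≤ i → i ≤ k →
        |iteratedDeriv i (fun ϑ : ℝ =>
            klFlatCutoffFn μ (WithLp.ofLp ((WithLp.toLp 2 (klFermiPoint μ K' ϑ) : EuclideanSpace ℝ (Fin 2)) - jshift w))) θ| *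
          |iteratedDeriv (k - i) (fun ϑ : ℝ =>
            klLocalPart L M β U μ (klFlowFrameU L M β U μ n) n
                (polarAngle (centredRep (WithLp.ofLp ((WithLp.toLp 2 (klFermiPoint μ K' ϑ) : EuclideanSpace ℝ (Fin 2)) - jshift w)))) -
              klAngularMean (fun θ => klLocalPart L M β U μ (klFlowFrameU L M β U μ n) n θ)) θ| ≤ pdef i w) ∧
      |klFlatCutoffFn μ (WithLp.ofLp ((WithLp.toLp 2 (klFermiPoint μ K' θ) : EuclideanSpace ℝ (Fin 2)) - jshift w))| *
        |iteratedDeriv k (fun ϑ : ℝ =>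
            klLocalPart L M β U μ (klFlowFrameU L M β U μ n) n
                (polarAngle (centredRep (WithLp.ofLp ((WithLp.toLp 2 (klFermiPoint μ K' ϑ) : EuclideanSpace ℝ (Fin 2)) - jshift w)))) -
              klAngularMean (fun θ => klLocalPart L M β U μ (klFlowFrameU L M β U μ n) n θ)) θ -
          iteratedDeriv k (fun ϑ : ℝ => klLocalPart L M β U μ (klFlowFrameU L M β U μ n) n ϑ -
              klAngularMean (fun θ => klLocalPart L M β U μ (klFlowFrameU L M β U μ n) n θ)) θ| ≤ tdef w ∧
      |klFlatCutoffFn μ (WithLp.ofLp ((WithLp.toLp 2 (klFermiPoint μ K' θ) : EuclideanSpace ℝ (Fin 2)) - jshift w)) - 1| *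
        |iteratedDeriv k (fun ϑ : ℝ => klLocalPart L M β U μ (klFlowFrameU L M β U μ n) n ϑ -
            klAngularMean (fun θ => klLocalPart L M β U μ (klFlowFrameU L M β U μ n) n θ)) θ| ≤ edef w)
    {Mx : ℕ → ℝ} (hMx : ∀ i, 1 ≤ i → i ≤ k → ∫ w, jweight (klFlowDeg n) w * pdef i w ∂jmeas ≤ Mx i)
    {Tm : ℝ} (hTm : ∫ w, jweight (klFlowDeg n) w * tdef w ∂jmeas ≤ Tm)
    {Em : ℝ} (hEm : ∫ w, jweight (klFlowDeg n) w * edef w ∂jmeas ≤ Em) :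
    |iteratedDeriv k (fun θ => klLocalPart L M β U μ (klFlowFrameU L M β U μ n) n θ -
        (klFlowPiece L M β U μ n).eval (klFermiPoint μ K' θ)) θ| ≤
      (∑ i ∈ Finset.range k, ((k.choose (i + 1) : ℕ) : ℝ) * Mx (i + 1)) + Tm + Em := by
  set f : ℝ → ℝ := fun θ => klLocalPart L M β U μ (klFlowFrameU L M β U μ n) n θ with hfdef
  set F : (Fin 2 → ℝ) → ℝ := klFrameExtFn μ f with hFdef
  set γ : ℝ → EuclideanSpace ℝ (Fin 2) := fun θ => WithLp.toLp 2 (klFermiPoint μ K' θ) with hγdef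
  set A : EuclideanSpace ℝ (Fin 2) → ℝ := fun q => f (polarAngle (centredRep (WithLp.ofLp q))) - klAngularMean f with hAdef
  have hper : Function.Periodic f (2 * Real.pi) := klLocalPart_periodic β U μ _ n
  have hG : ContDiff ℝ 4 (fun q : EuclideanSpace ℝ (Fin 2) => F (WithLp.ofLp q)) := contDiff_onM_klFrameExtFn (N := 4) hf hper hμ
  have hFc : Continuous F := continuous_klFrameExtFn_of_contDiff hG
  have hχ : ContDiff ℝ 4 (fun q : EuclideanSpace ℝ (Fin 2) => klFlatCutoffFn μ (WithLp.ofLp q)) := contDiff_klFlatCutoffFn_ofLp μ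
  have hflat' : ∀ ϑ : ℝ, (fun q : EuclideanSpace ℝ (Fin 2) => klFlatCutoffFn μ (WithLp.ofLp q)) (γ ϑ) = 1 := fun ϑ => by
    simp only [hγdef, WithLp.ofLp_toLp]; exact hflat ϑ
  have hGdec : ∀ q : EuclideanSpace ℝ (Fin 2), F (WithLp.ofLp q) =
      klAngularMean f + (fun q : EuclideanSpace ℝ (Fin 2) => klFlatCutoffFn μ (WithLp.ofLp q)) q * A q := fun q =>
    klFrameExtFn_ofLp_eq_mean_add_cutoff_mul μ f q
  -- along the curve the angular factor IS the mean-free profile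
  have hA0 : (fun ϑ : ℝ => A (γ ϑ)) = fun ϑ : ℝ => f ϑ - klAngularMean f := by
    funext ϑ; simp only [hAdef, hγdef, hfdef]; rw [hang ϑ]
  have hsm := ae_jmeas_contDiffAt_angularFactor_comp_curve_sub hf hper (klAngularMean f) hγ θ
  have hw' : ∀ᵐ w ∂jmeas, ContDiffAt ℝ 4 (fun ϑ : ℝ => A (γ ϑ - jshift w)) θ ∧
      (∀ i, 1 ≤ i → i ≤ k → |iteratedDeriv i (fun ϑ : ℝ => (fun q : EuclideanSpace ℝ (Fin 2) => klFlatCutoffFn μ (WithLp.ofLp q)) (γ ϑ - jshift w)) θ| *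
          |iteratedDeriv (k - i) (fun ϑ : ℝ => A (γ ϑ - jshift w)) θ| ≤ pdef i w) ∧
      |(fun q : EuclideanSpace ℝ (Fin 2) => klFlatCutoffFn μ (WithLp.ofLp q)) (γ θ - jshift w)| *
          |iteratedDeriv k (fun ϑ : ℝ => A (γ ϑ - jshift w)) θ - iteratedDeriv k (fun ϑ : ℝ => A (γ ϑ)) θ| ≤ tdef w ∧
      |(fun q : EuclideanSpace ℝ (Fin 2) => klFlatCutoffFn μ (WithLp.ofLp q)) (γ θ - jshift w) - 1| *
          |iteratedDeriv k (fun ϑ : ℝ => A (γ ϑ)) θ| ≤ edef w := by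
    filter_upwards [hsm, hw] with w h1 h2
    refine ⟨h1, h2.1, ?_, ?_⟩
    · rw [hA0]; exact h2.2.1
    · rw [hA0]; exact h2.2.2
  rw [jacksonObject_eq_jhigh1_comp_curve (L := L) (M := M) β U hμ n K' hf hon]
  exact abs_iteratedDeriv_jhigh1_comp_curve_le_weightedMoments_ae (klFlowDeg n) hFc hG hγ hk θ hGdec hflat' hχ hpint htint heint
    hw' hMx hTm hEm

end Flow

end Summit.HubbardSuperconductivity.HubbardSuperconductivity.Theorems.KLRegimeSplit

end
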